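import Literature.AnabelianGeometry.EtaleTheta.SettingModelChiMuTwo
import Literature.AnabelianGeometry.EtaleTheta.SettingModelChiCensusClauses
import Literature.AnabelianGeometry.EtaleTheta.SettingModel2InversionCoverings
import HarnessLib

/-!
# The χ-twisted root model of [EtTh] §1 (R78), file F8ι: a Def. 1.7 layer over `modelχ` in which `ε_±` IS the
# inversion — `Π^tp_C := Π^tp_X ⋊_ι ℤ/2`, `ι` = the twisted inversion of `Γ ⋊_χ G_{ℚ_p}`

S. Mochizuki, *The étale theta function and its Frobenioid-theoretic manifestations*, Publ. RIMS **45** (2009) [EtTh],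
Def. 1.7, PRIMS PDF p. 27 (printed 253): «`C^log` … the stack-theoretic quotient of `X^log` by the natural action of `±1`»,
«`Ẍ^log → X^log` … the Galois covering of degree `4` determined by the multiplication by `2` map», «`Gal(Ẍ^log/C^log) ≅
(ℤ/2ℤ)³`», «`ε_± ∈ Gal(Ẍ/C)`» (lifting `−1`), «a nontrivial element `ε_Z ∈ Gal(Ẍ/X)` which is `≠ ε_μ`»; §2 p. 36 «`ι` …
“multiplication by `−1`”»; Prop. 2.2 (i) p. 37 [cite: MochizukiEtTh2009, Def 1.7 p.27]. Layer L2 of the abc-iut cell,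
R78 cluster (χ-twisted model; integrator abc-iut-L6-d6, file map «Π^tp_C := Π^tp_X ⋊_ι ℤ/2»), hand F8ι = seat
abc-iut-w5-d140 (gen 4; K2 holder lineage — the carrier the deck / `ι` rows of [EtTh] Def. 1.9, Rmk. 1.9.1 and the
K2/K3 residual census want at a KUMMER-CARRYING model).

Two Def. 1.7 inhabitants already exist: abc-iut-L2-t1's `MuTwoSetting.model` / abc-iut-w5-d072's
`MuTwoSetting.inversionModel` over the DISCRETE root (`SettingModelMuTwo`, `SettingModelMuTwoInversion` — Kummer data
EMPTY there, abc-iut-w5-d171 `SettingModelKummerDataEmpty`), and abc-iut-f-113's `MuTwoSetting.modelχ`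
(`SettingModelChiMuTwo`, F8) over the χ-twisted root `ThetaSetting.modelχ p` with `Π^tp_C := Π^tp_X × ℤ/2` — there
`ε_±` is CENTRAL, so conjugation by `ε_±` is the identity of `Π^tp_X`. THIS FILE is the fourth inhabitant = the
χ-twisted analogue of `inversionModel`: over the SAME `ThetaSetting.modelχ p` and the SAME `Π^tp_Ẍ := Xddχ p`, `ε_μ := b`,
`ε_Z := a` of F8 (abc-iut-f-113's `parityχ` / `Xddχ` / `xyTwo` / `dXdd` / `epsZχ`-shape consumed BY NAME, nothing
re-derived), but with
* `Π^tp_C := Π^tp_X ⋊_ι ℤ/2` (`PiCInvχ`, an `abbrev` for Mathlib's `SemidirectProduct`, topologised by the induced topology along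
  `g ↦ (g.left, g.right)` — abc-iut-L2-t1/w5-d249's `Semidirect` toolkit `SettingModelSemidirectTopology`), where
  `ι := twistedInversion (chi p)` is abc-iut-w5-d072's inversion of `Γ ⋊_χ G_{ℚ_p}` (`SettingModelChiTwistInversion`:
  `(γ, σ) ↦ (ι_Γ γ, σ)`, `ι_Γ (x, n) = (σ̂ x, n⁻¹)`), through `invActionχ : ℤ/2 →* Aut(Π^tp_X)` (generator `↦ ι`, `ι² = 1`);
* `Π^tp_Ẍ = Xddχ p` is `ι`-STABLE because `ι_Γ` NEGATES the level-`2` Heisenberg shadow (abc-iut-w5-d072's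
  `levelHom_gfpInv : ĥ₂(ι_Γ γ) = negXY (ĥ₂ γ)`) and `−t = t` in `ℤ/2` (`xyTwo_gfpInv`, `parityχ_twistedInversion`); hence
  `x · ι(x) ∈ Π^tp_Ẍ` (the square law `(x, ε_±)² = (x·ι x, 1)` of `Gal(Ẍ/C) ≅ (ℤ/2)³`) and `inl(Π^tp_Ẍ)` is normal in
  `Π^tp_C`;
* **`ε_± := inr(1̄)`**, so that **`ε_± · inclX x · ε_±⁻¹ = inclX (ι x)`** (`epsPM_conj_inlχ`, Mathlib
  `SemidirectProduct.inl_aut`).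
RESULTS: **`MuTwoSetting.inversionModelχ p : MuTwoSetting p`**, `inversionModelχ_toThetaSetting : _ = ThetaSetting.modelχ p`
(`rfl`), `inversionModelχ_isEtThOrigin`, `inversionModelχ_compat`, `inversionModelχ_isAdmissibleEpsZ` (`ε_Z := a`),
`inversionModelχ_epsPM_conj`, `isInducing_inclX_inversionModelχ` ((R1d) `hind`), and the joint-satisfiability
headline `MuTwoSetting.exists_epsPM_realises_inversion_and_nonempty_kummerData`: **the Def. 1.7 interface, the
origin guard, `Compat`, an admissible `ε_Z`, a Kummer datum, (R1d), AND a topological automorphism `ι` of `Π^tp_X`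
REALISING `ε_±`-conjugation which is a nontrivial involution over `G_K` with (R1b′) `ι(Δ^tp_X) = Δ^tp_X`, (R1c)
`toZ ∘ ι = toZ⁻¹` and (R1e′) «`ι̂ ≡ −1` on `Δ_X^ab`» are JOINTLY SATISFIABLE** — the χ-twisted (Kummer-carrying)
companion of abc-iut-w5-d072's `exists_epsPM_realises_inversion` (whose witness has NO Kummer data); the facets are
abc-iut-L2-t10's `SettingModelChiCensusClauses` rows BY NAME.

HONEST LIMITS: a semi-synthetic model (the χ-twisted root; not the tempered fundamental group of an orbicurve);
consistency / non-vacuity evidence for the typed interface ONLY. Class (b) MODEL/CONSTRUCTION file over the FROZEN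
interface `MuTwoSetting` (no interface clause touched): definitions `invActionχ`, the NEW carrier `PiCInvχ`
(instances `TopologicalSpace` / `IsTopologicalGroup` on the new carrier ONLY — the pattern of `PiTpχ`), `inclInvχ`, `toGalXCχ`,
`epsPMInvχ`, `epsZInvχ`, the term `MuTwoSetting.inversionModelχ`; no `Prop` facts; nothing of [EtTh] is asserted; no side
is taken on [IUTchIII] Cor. 3.12; typed ≠ proved; instantiated ≠ endorsed.
-/

noncomputable section

namespace Literature.AnabelianGeometry.EtaleTheta.SettingModel

open Literature.AnabelianGeometry.SemiGraphs
open _root_.Topology _root_.Function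

variable (p : ℕ) [Fact p.Prime]

/-! ### `ι`-stability of `Π^tp_Ẍ = Xddχ` and the square law -/

/-- In `ℤ/2ℤ` every element is its own negative. [folklore] -/
private theorem neg_eq_self_zmod_two (a : ZMod ((2 : ℕ+) : ℕ)) : -a = a := by
  revert a
  decide

/-- **`ι_Γ` fixes the parity character of `Γ`**: `xyTwo (ι_Γ γ) = xyTwo γ` (`ĥ₂ ∘ ι_Γ = negXY ∘ ĥ₂` and `−t = t`
mod `2`). [cite: MochizukiEtTh2009, Prop 2.2 (i) p.37] -/
theorem xyTwo_gfpInv (γ : Gfp) : xyTwo (gfpInv γ) = xyTwo γ := by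
  rw [xyTwo_apply, xyTwo_apply, levelHom_gfpInv, Heis.negXY_x, Heis.negXY_y, neg_eq_self_zmod_two,
    neg_eq_self_zmod_two]

/-- **`ι` fixes the parity character of `Π^tp_X`**: `parityχ (ι g) = parityχ g`. [cite: MochizukiEtTh2009, Prop 2.2 (i) p.37] -/
theorem parityχ_twistedInversion (g : PiTpχ p) :
    parityχ p (twistedInversion (chi p) g) = parityχ p g := by
  rw [parityχ_apply, parityχ_apply, twistedInversion_left, xyTwo_gfpInv]

/-- **`Π^tp_Ẍ` is `ι`-stable**: `ι g ∈ Π^tp_Ẍ ↔ g ∈ Π^tp_Ẍ`. [cite: MochizukiEtTh2009, Def 1.7 p.27] -/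
theorem twistedInversion_mem_Xddχ_iff (g : PiTpχ p) :
    twistedInversion (chi p) g ∈ Xddχ p ↔ g ∈ Xddχ p := by
  rw [Xddχ, MonoidHom.mem_ker, MonoidHom.mem_ker, parityχ_twistedInversion]

/-- **`g · ι(g) ∈ Π^tp_Ẍ`** for every `g ∈ Π^tp_X` (parity `t · t = 1`): the square law `(g, ε_±)² = (g·ι g, 1) ∈ Π^tp_Ẍ`
of `Gal(Ẍ/C) ≅ (ℤ/2)³`. [cite: MochizukiEtTh2009, Def 1.7 p.27] -/
theorem mul_twistedInversion_mem_Xddχ (g : PiTpχ p) : g * twistedInversion (chi p) g ∈ Xddχ p := by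
  have h := mul_self_mem_Xddχ p g
  rw [Xddχ, MonoidHom.mem_ker, map_mul] at h ⊢
  rwa [parityχ_twistedInversion]

/-! ### The action of `ℤ/2` on `Π^tp_X` through `ι` and `Π^tp_C := Π^tp_X ⋊_ι ℤ/2` -/

/-- `ι ∘ ι = 1` in `Aut(Π^tp_X)`. [cite: MochizukiEtTh2009, §2 p.36] -/
theorem twistedInversion_mul_twistedInversion :
    twistedInversion (chi p) * twistedInversion (chi p) = (1 : MulAut (PiTpχ p)) :=
  MulEquiv.ext fun g => twistedInversion_twistedInversion (chi p) g

/-- **The action `ℤ/2 → Aut(Π^tp_X)`, generator `↦ ι`** (well defined since `ι² = 1`). DEFINED.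
[cite: MochizukiEtTh2009, Def 1.7 p.27] -/
def invActionχ : Multiplicative (ZMod 2) →* MulAut (PiTpχ p) where
  toFun z := if z = 1 then 1 else twistedInversion (chi p)
  map_one' := if_pos rfl
  map_mul' a b := by
    have key : ∀ z : Multiplicative (ZMod 2), z = 1 ∨ z = Multiplicative.ofAdd 1 := by decide
    have hne : (Multiplicative.ofAdd (1 : ZMod 2)) ≠ 1 := by decide
    have hsq : Multiplicative.ofAdd (1 : ZMod 2) * Multiplicative.ofAdd 1 = 1 := by decide
    rcases key a with rfl | rfl <;> rcases key b with rfl | rfl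
    · simp
    · simp [hne]
    · simp [hne]
    · rw [hsq, if_pos rfl, if_neg hne, twistedInversion_mul_twistedInversion]

/-- The generator acts by `ι`. [cite: MochizukiEtTh2009, Def 1.7 p.27] -/
theorem invActionχ_ofAdd_one : invActionχ p (Multiplicative.ofAdd 1) = twistedInversion (chi p) := by
  change (if Multiplicative.ofAdd (1 : ZMod 2) = 1 then (1 : MulAut (PiTpχ p)) else twistedInversion (chi p)) = _
  rw [if_neg (by decide)]

/-- `φ(z)` is `1` or `ι`. [cite: MochizukiEtTh2009, Def 1.7 p.27] -/
theorem invActionχ_eq (z : Multiplicative (ZMod 2)) :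
    invActionχ p z = 1 ∨ invActionχ p z = twistedInversion (chi p) := by
  have key : ∀ z : Multiplicative (ZMod 2), z = 1 ∨ z = Multiplicative.ofAdd 1 := by decide
  rcases key z with rfl | rfl
  · exact Or.inl (map_one _)
  · exact Or.inr (invActionχ_ofAdd_one p)

/-- Each `φ(z)` is continuous on `Π^tp_X` (`ι` is, for the topology induced by `(left, right)` — abc-iut-w5-d072's
`continuous_twistedInversion`). [cite: MochizukiEtTh2009, §2 p.36] -/
theorem continuous_invActionχ_apply (z : Multiplicative (ZMod 2)) : Continuous (invActionχ p z : PiTpχ p → PiTpχ p) := by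
  rcases invActionχ_eq p z with h | h <;> rw [h]
  · exact continuous_id
  · exact continuous_twistedInversion (chi p) (isInducing_leftRightχ p)

/-- The action map `(z, g) ↦ φ(z)(g)` is jointly continuous (`ℤ/2` is discrete). [cite: MochizukiEtTh2009, Def 1.7 p.27] -/
theorem continuous_invActionχ : Continuous fun q : Multiplicative (ZMod 2) × PiTpχ p => invActionχ p q.1 q.2 :=
  continuous_prod_of_discrete_left.mpr fun z => continuous_invActionχ_apply p z

/-- `g · φ(z)(g) ∈ Π^tp_Ẍ` for every `g`. [cite: MochizukiEtTh2009, Def 1.7 p.27] -/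
theorem mul_invActionχ_mem_Xddχ (z : Multiplicative (ZMod 2)) (g : PiTpχ p) : g * invActionχ p z g ∈ Xddχ p := by
  rcases invActionχ_eq p z with h | h <;> rw [h]
  · exact mul_self_mem_Xddχ p g
  · exact mul_twistedInversion_mem_Xddχ p g

/-- `φ(z)` preserves `Π^tp_Ẍ`. [cite: MochizukiEtTh2009, Def 1.7 p.27] -/
theorem invActionχ_mem_Xddχ (z : Multiplicative (ZMod 2)) {g : PiTpχ p} (hg : g ∈ Xddχ p) : invActionχ p z g ∈ Xddχ p := by
  rcases invActionχ_eq p z with h | h <;> rw [h]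
  · exact hg
  · exact (twistedInversion_mem_Xddχ_iff p g).mpr hg

/-- **`Π^tp_C := Π^tp_X ⋊_ι ℤ/2`** — the model of the tempered fundamental group of `C^log = X^log/{±1}` over the
χ-twisted root in which the non-identity coset acts on `Π^tp_X` by the inversion `ι` (a type synonym of Mathlib's
semidirect product). DEFINED. [cite: MochizukiEtTh2009, Def 1.7 p.27] -/
abbrev PiCInvχ : Type := PiTpχ p ⋊[invActionχ p] Multiplicative (ZMod 2)

/-- The topology of `Π^tp_C`: induced along `g ↦ (g.left, g.right) ∈ Π^tp_X × ℤ/2` (`ℤ/2` discrete) — an instance on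
the NEW carrier only (Mathlib's semidirect product carries no topology). [cite: MochizukiEtTh2009, Def 1.7 p.27] -/
instance instTopologicalSpacePiCInvχ : TopologicalSpace (PiCInvχ p) :=
  TopologicalSpace.induced (fun g : PiCInvχ p => (g.left, g.right)) inferInstance

/-- `g ↦ (g.left, g.right)` is inducing on `Π^tp_C` (by definition). [cite: MochizukiEtTh2009, Def 1.7 p.27] -/
theorem isInducing_leftRightCInvχ : IsInducing fun g : PiCInvχ p => (g.left, g.right) := ⟨rfl⟩

/-- **`Π^tp_C` is a topological group** (the `ℤ/2`-action is jointly continuous). [cite: MochizukiEtTh2009, Def 1.7 p.27] -/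
instance instIsTopologicalGroupPiCInvχ : IsTopologicalGroup (PiCInvχ p) :=
  haveI : IsTopologicalGroup (Multiplicative (ZMod 2)) :=
    { continuous_mul := continuous_of_discreteTopology, continuous_inv := continuous_of_discreteTopology }
  Semidirect.isTopologicalGroup_of_continuous_action (isInducing_leftRightCInvχ p) (continuous_invActionχ p)

/-- `Π^tp_X ↪ Π^tp_C`: the normal factor. DEFINED. [cite: MochizukiEtTh2009, Def 1.7 p.27] -/
def inclInvχ : PiTpχ p →* PiCInvχ p := SemidirectProduct.inl

/-- The quotient `Π^tp_C ↠ ℤ/2 = Gal(X/C)`. DEFINED. [cite: MochizukiEtTh2009, Def 1.7 p.27] -/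
def toGalXCχ : PiCInvχ p →* Multiplicative (ZMod 2) := SemidirectProduct.rightHom

/-- **`ε_± := (1, 1̄)`**, the generator of the complement `ℤ/2` — it lifts `−1`. DEFINED. [cite: MochizukiEtTh2009, Def 1.7 p.27] -/
def epsPMInvχ : PiCInvχ p := SemidirectProduct.inr (Multiplicative.ofAdd 1)

/-- `ε_Z := a` read in `Π^tp_C` (the admissible choice, as in F8). DEFINED. [cite: MochizukiEtTh2009, Def 1.7 p.27] -/
def epsZInvχ : PiCInvχ p := inclInvχ p (SemidirectProduct.inl (gfpOf (FreeGroup.of 0)))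

/-- `Π^tp_X = Ker(Π^tp_C ↠ ℤ/2)`. [cite: MochizukiEtTh2009, Def 1.7 p.27] -/
theorem range_inclInvχ : (inclInvχ p).range = (toGalXCχ p).ker :=
  SemidirectProduct.range_inl_eq_ker_rightHom

/-- `Π^tp_C ↠ ℤ/2` is onto. [cite: MochizukiEtTh2009, Def 1.7 p.27] -/
theorem toGalXCχ_surjective : Surjective (toGalXCχ p) := SemidirectProduct.rightHom_surjective

/-- `Π^tp_X ↪ Π^tp_C` is continuous. [cite: MochizukiEtTh2009, Def 1.7 p.27] -/
theorem continuous_inclInvχ : Continuous (inclInvχ p) := Semidirect.continuous_inl (isInducing_leftRightCInvχ p)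

/-- `Π^tp_C ↠ ℤ/2` is continuous. [cite: MochizukiEtTh2009, Def 1.7 p.27] -/
theorem continuous_toGalXCχ : Continuous (toGalXCχ p) := Semidirect.continuous_right (isInducing_leftRightCInvχ p)

/-- The image of `Π^tp_X` is OPEN in `Π^tp_C` (the kernel of a continuous map to the discrete `ℤ/2`).
[cite: MochizukiEtTh2009, Def 1.7 p.27] -/
theorem isOpen_range_inclInvχ : IsOpen ((inclInvχ p).range : Set (PiCInvχ p)) := by
  rw [range_inclInvχ, MonoidHom.coe_ker]
  exact (isOpen_discrete ({1} : Set (Multiplicative (ZMod 2)))).preimage (continuous_toGalXCχ p)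

/-- **`inclX : Π^tp_X ↪ Π^tp_C` induces the topology of `Π^tp_X`** ((R1d) `hind`): `(left, right) ∘ inl = (·, 1)`.
[cite: MochizukiEtTh2009, Def 1.7 p.27] -/
theorem isInducing_inclInvχ : IsInducing (inclInvχ p) := by
  rw [← (isInducing_leftRightCInvχ p).of_comp_iff]
  exact isInducing_prodMkLeft (1 : Multiplicative (ZMod 2))

/-- **`ε_± · x · ε_±⁻¹ = ι(x)` on `Π^tp_X`**: conjugation by `ε_±` IS the twisted inversion (Mathlib
`SemidirectProduct.inl_aut`). [cite: MochizukiEtTh2009, §2 p.36] -/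
theorem epsPM_conj_inlχ (x : PiTpχ p) :
    epsPMInvχ p * inclInvχ p x * (epsPMInvχ p)⁻¹ = inclInvχ p (twistedInversion (chi p) x) := by
  have h := SemidirectProduct.inl_aut (φ := invActionχ p) (Multiplicative.ofAdd (1 : ZMod 2)) x
  rw [invActionχ_ofAdd_one] at h
  change epsPMInvχ p * inclInvχ p x * (epsPMInvχ p)⁻¹ = SemidirectProduct.inl (twistedInversion (chi p) x)
  rw [h, epsPMInvχ, map_inv]
  rfl

/-- The image of `Π^tp_Ẍ` in `Π^tp_C` is normal (`Π^tp_Ẍ` is normal in `Π^tp_X` and `ι`-stable). [cite: MochizukiEtTh2009, Def 1.7 p.27] -/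
theorem map_inclInvχ_Xddχ_normal : ((Xddχ p).map (inclInvχ p)).Normal := by
  haveI := Xddχ_normal p
  refine ⟨?_⟩
  rintro _ ⟨h, hh, rfl⟩ y
  refine ⟨y.left * invActionχ p y.right h * y.left⁻¹,
    (Xddχ_normal p).conj_mem _ (invActionχ_mem_Xddχ p y.right hh) y.left, ?_⟩
  change SemidirectProduct.inl _ = y * SemidirectProduct.inl h * y⁻¹
  rw [map_mul, map_mul, map_inv, SemidirectProduct.inl_aut, map_inv]
  conv_rhs => rw [← SemidirectProduct.inl_left_mul_inr_right y]
  rw [mul_inv_rev]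
  group

/-- The square of `(x, z)` is `(x · φ(z)(x), 1)` (`z² = 1` in `ℤ/2`). [cite: MochizukiEtTh2009, Def 1.7 p.27] -/
theorem sq_eq_inlχ (g : PiCInvχ p) :
    g * g = inclInvχ p (SemidirectProduct.left g * invActionχ p (SemidirectProduct.right g) (SemidirectProduct.left g)) := by
  have h2 : ∀ t : Multiplicative (ZMod 2), t * t = 1 := by decide
  refine SemidirectProduct.ext ?_ ?_
  · rfl
  · change SemidirectProduct.right g * SemidirectProduct.right g = 1
    exact h2 _

/-! ### The inhabitant -/

/-- **The inversion model of [EtTh] Def. 1.7 over the χ-twisted root.** An inhabitant of `MuTwoSetting p` over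
`ThetaSetting.modelχ p` with `Π^tp_C := Π^tp_X ⋊_ι ℤ/2`, `Π^tp_Ẍ := Xddχ p` (abc-iut-f-113's F8, even level-`2`
parities), `ε_μ := b`, `ε_± := (1, 1̄)` — so that conjugation by `ε_±` on `Π^tp_X` is the twisted inversion
`(γ, σ) ↦ (ι_Γ γ, σ)`. Semi-synthetic; consistency evidence only. DEFINED. [cite: MochizukiEtTh2009, Def 1.7 p.27] -/
abbrev _root_.Literature.AnabelianGeometry.EtaleTheta.MuTwoSetting.inversionModelχ : MuTwoSetting p where
  toThetaSetting := ThetaSetting.modelχ p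
  sqrtqX_mem_K := (MuTwoSetting.modelχ p).sqrtqX_mem_K
  GtpC := PiCInvχ p
  inclX := inclInvχ p
  continuous_inclX := continuous_inclInvχ p
  injective_inclX := SemidirectProduct.inl_injective
  isOpen_range_inclX := isOpen_range_inclInvχ p
  range_inclX_normal := by
    rw [range_inclInvχ]
    infer_instance
  index_range_inclX := by
    rw [range_inclInvχ, Subgroup.index_ker, MonoidHom.range_eq_top.mpr (toGalXCχ_surjective p), Subgroup.card_top]
    change Nat.card (ZMod 2) = 2
    exact Nat.card_zmod 2
  GtpXdd := Xddχ p
  index_GtpXdd := index_Xddχ p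
  map_GtpXdd_normal := map_inclInvχ_Xddχ_normal p
  sq_mem_GtpXdd g := by
    rw [sq_eq_inlχ]
    exact ⟨_, mul_invActionχ_mem_Xddχ p _ _, rfl⟩
  GtpYdd_le_GtpXdd := gtpYdd_modelχ_le_Xddχ p
  epsMu := inclInvχ p (SemidirectProduct.inl (gfpOf (FreeGroup.of 1)))
  epsMu_mem := ⟨_, rfl⟩
  epsMu_not_mem := by
    rintro ⟨y, hy, hyy⟩
    have h := SemidirectProduct.inl_injective hyy
    subst h
    exact inl_gfpOf_one_not_mem_Xddχ p hy
  epsPM := epsPMInvχ p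
  epsPM_not_mem := by
    rintro ⟨y, hy⟩
    have h := congrArg (toGalXCχ p) hy
    change SemidirectProduct.rightHom (SemidirectProduct.inl y) =
      SemidirectProduct.rightHom (SemidirectProduct.inr (Multiplicative.ofAdd 1)) at h
    rw [SemidirectProduct.rightHom_inl, SemidirectProduct.rightHom_inr] at h
    exact absurd h (by decide)

/-- The inversion model sits over the χ-twisted root. [cite: MochizukiEtTh2009, Def 1.7 p.27] -/
theorem _root_.Literature.AnabelianGeometry.EtaleTheta.MuTwoSetting.inversionModelχ_toThetaSetting :
    (MuTwoSetting.inversionModelχ p).toThetaSetting = ThetaSetting.modelχ p := rfl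

/-- … it has the same underlying theta setting as abc-iut-f-113's product model `MuTwoSetting.modelχ`.
[cite: MochizukiEtTh2009, Def 1.7 p.27] -/
theorem _root_.Literature.AnabelianGeometry.EtaleTheta.MuTwoSetting.inversionModelχ_toThetaSetting_eq_modelχ :
    (MuTwoSetting.inversionModelχ p).toThetaSetting = (MuTwoSetting.modelχ p).toThetaSetting := rfl

/-- … hence satisfies the guard `IsEtThOrigin`. [cite: MochizukiEtTh2009, §1 p.12] -/
theorem _root_.Literature.AnabelianGeometry.EtaleTheta.MuTwoSetting.inversionModelχ_isEtThOrigin :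
    (MuTwoSetting.inversionModelχ p).toThetaSetting.IsEtThOrigin :=
  ThetaSetting.modelχ_isEtThOrigin p

/-- … and `Compat`. [cite: MochizukiEtTh2009, Prop 1.5 p.22] -/
theorem _root_.Literature.AnabelianGeometry.EtaleTheta.MuTwoSetting.inversionModelχ_compat :
    (MuTwoSetting.inversionModelχ p).toThetaSetting.Compat :=
  (ThetaSetting.modelχ p).compat

/-- `ε_±` of the inversion model is the generator of the complement. [cite: MochizukiEtTh2009, Def 1.7 p.27] -/
theorem _root_.Literature.AnabelianGeometry.EtaleTheta.MuTwoSetting.inversionModelχ_epsPM :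
    (MuTwoSetting.inversionModelχ p).epsPM = epsPMInvχ p := rfl

/-- `inclX` of the inversion model is `inl`. [cite: MochizukiEtTh2009, Def 1.7 p.27] -/
theorem _root_.Literature.AnabelianGeometry.EtaleTheta.MuTwoSetting.inversionModelχ_inclX (x : PiTpχ p) :
    (MuTwoSetting.inversionModelχ p).inclX x = inclInvχ p x := rfl

/-- **`ε_± · inclX x · ε_±⁻¹ = inclX (ι x)`** in the inversion model over `modelχ`: `ε_±`-conjugation on `Π^tp_X` is the
twisted inversion `twistedInversionTop (chi p)`. [cite: MochizukiEtTh2009, §2 p.36] -/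
theorem _root_.Literature.AnabelianGeometry.EtaleTheta.MuTwoSetting.inversionModelχ_epsPM_conj (x : PiTpχ p) :
    (MuTwoSetting.inversionModelχ p).epsPM * (MuTwoSetting.inversionModelχ p).inclX x *
        (MuTwoSetting.inversionModelχ p).epsPM⁻¹ =
      (MuTwoSetting.inversionModelχ p).inclX (twistedInversionTop (chi p) (isInducing_leftRightχ p) x) :=
  epsPM_conj_inlχ p x

/-- **`ε_Z := a` is admissible** in the inversion model (`a ∉ Π^tp_Ẍ`, `a·b⁻¹ ∉ Π^tp_Ẍ` — abc-iut-f-113's parities).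
[cite: MochizukiEtTh2009, Def 1.7 p.27] -/
theorem _root_.Literature.AnabelianGeometry.EtaleTheta.MuTwoSetting.inversionModelχ_isAdmissibleEpsZ :
    (MuTwoSetting.inversionModelχ p).IsAdmissibleEpsZ (epsZInvχ p) := by
  refine ⟨⟨_, rfl⟩, ?_, ?_⟩
  · rintro ⟨y, hy, hyy⟩
    have h := SemidirectProduct.inl_injective hyy
    subst h
    exact inl_gfpOf_zero_not_mem_Xddχ p hy
  · change inclInvχ p (SemidirectProduct.inl (gfpOf (FreeGroup.of 0))) *
        (inclInvχ p (SemidirectProduct.inl (gfpOf (FreeGroup.of 1))))⁻¹ ∉ (Xddχ p).map (inclInvχ p)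
    rw [← map_inv, ← map_mul]
    rintro ⟨y, hy, hyy⟩
    have h := SemidirectProduct.inl_injective hyy
    subst h
    exact inl_gfpOf_zero_mul_inv_not_mem_Xddχ p hy

/-- **(R1d) at the inversion model over `modelχ`**: `inclX` induces the topology of `Π^tp_X`.
[cite: MochizukiEtTh2009, Def 1.7 p.27] -/
theorem _root_.Literature.AnabelianGeometry.EtaleTheta.MuTwoSetting.isInducing_inclX_inversionModelχ :
    IsInducing (MuTwoSetting.inversionModelχ p).inclX :=
  isInducing_inclInvχ p

/-! ### Joint satisfiability: Def. 1.7 with `ε_±` a genuine inversion AT A KUMMER-CARRYING MODEL -/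

/-- **[EtTh] Def. 1.7's interface admits a KUMMER-CARRYING model in which `ε_±` acts on `Π^tp_X` as a genuine
inversion.** There is `M : MuTwoSetting p` with the origin guard, `Compat`, an admissible `ε_Z`, a Kummer datum
(`Nonempty M.KummerData`, abc-iut-w5-d171's `kummerDataχ`), `inclX` inducing (R1d), and a topological automorphism `ι`
of `Π^tp_X` REALISING conjugation by `ε_±` (`inclX (ι x) = ε_± · inclX x · ε_±⁻¹`) which is a nontrivial involution
over `G_K` with (R1b′) `ι(Δ^tp_X) = Δ^tp_X`, (R1c) `toZ (ι x) = (toZ x)⁻¹` and (R1e′) «`ι̂ ≡ −1` on `Δ_X^ab`»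
(`∀ g ∈ Δ_X, ι̂ g · g ∈ closure ⁅Δ_X, Δ_X⁆`) — witness `MuTwoSetting.inversionModelχ p` with
`ι := twistedInversionTop (chi p)` (facets: abc-iut-L2-t10's `SettingModelChiCensusClauses`). The Kummer-carrying
companion of abc-iut-w5-d072's `MuTwoSetting.exists_epsPM_realises_inversion` (discrete root, Kummer data empty).
[cite: MochizukiEtTh2009, Prop 2.2 (i) p.37] -/
theorem _root_.Literature.AnabelianGeometry.EtaleTheta.MuTwoSetting.exists_epsPM_realises_inversion_and_nonempty_kummerData :
    ∃ M : MuTwoSetting p, M.toThetaSetting.IsEtThOrigin ∧ M.toThetaSetting.Compat ∧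
      (∃ εZ : M.GtpC, M.IsAdmissibleEpsZ εZ) ∧ Nonempty M.toThetaSetting.KummerData ∧ IsInducing M.inclX ∧
      ∃ ι : M.PiTemp ≃ₜ* M.PiTemp, (∀ x, M.inclX (ι x) = M.epsPM * M.inclX x * M.epsPM⁻¹) ∧
        ι ≠ ContinuousMulEquiv.refl M.PiTemp ∧ (∀ g, ι (ι g) = g) ∧ (∀ g, M.aug (ι g) = M.aug g) ∧
        M.DeltaTemp.map ι.toMulEquiv.toMonoidHom = M.DeltaTemp ∧ (∀ g, M.toZ (ι g) = (M.toZ g)⁻¹) ∧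
        ∀ g ∈ M.DeltaHat, M.completionAut ι g * g ∈ (⁅M.DeltaHat, M.DeltaHat⁆).topologicalClosure :=
  ⟨MuTwoSetting.inversionModelχ p, MuTwoSetting.inversionModelχ_isEtThOrigin p, MuTwoSetting.inversionModelχ_compat p,
    ⟨_, MuTwoSetting.inversionModelχ_isAdmissibleEpsZ p⟩, nonempty_kummerData_modelχ p,
    MuTwoSetting.isInducing_inclX_inversionModelχ p, twistedInversionTop (chi p) (isInducing_leftRightχ p),
    fun x => (epsPM_conj_inlχ p x).symm, (twistedInversion_involutive_ne_refl_modelχ p).2,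
    (twistedInversion_involutive_ne_refl_modelχ p).1, aug_twistedInversion_modelχ p,
    map_deltaTemp_twistedInversion_modelχ p, toZ_twistedInversion_modelχ p, twistedInversion_hinv_modelχ p⟩

end Literature.AnabelianGeometry.EtaleTheta.SettingModel

end
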